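import Mathlib
import Summits.Parity.GeneralizedHardyLittlewood.Theorems.LeeYangFibresCellParityLawP2Defs

/-!
# Sketch — crux stmt-Parity-18104 `LeeYangFibres.CellParityLawSaving`, ideator 2 (round 1)
# Idea `permutation-ghosts-sandwich-lp`: first checkable statements

Nothing here is asserted; every `def … : Prop` is a STATEMENT.  The only proofs are the closure
properties of the invisible submodule (linear algebra bookkeeping).

* `permWeight`, `join`, `InvisibleAt` — the permutation (cycle-index) model `Model_M` of Bombieri's sieve at
  level `x^{1-η}`, `η = H/M`: "integers of size x" = partitions of `M` (part `k` = prime of size `x^{k/M}`),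
  weight = cycle-index probability × `M`, Type-I data of level `M - H` = conditional cofactor averages.
* `CycleIndexVanishing`, `GhostFamily` — FIRST LEMMA (provable now): the explicit ghosts `(-j)^{#parts}`,
  `1 ≤ j ≤ H - 1`, are invisible at deficit `H` (rising-factorial identity `Σ_{σ∈S_n} y^{cyc σ} = y^{(n)}`).
* `InvisibleDimension` — the structure theorem (Young's rule): the invisible space has dimension
  `#{partitions of M with all parts < H}` (= `#{λ ⊢ M : λ₁ < H}`, the span of the `S_M`-characters with first
  row shorter than the deficit); verified by exact rank computation for `M ≤ 18`, `H ≤ 7` this session.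
* `RoughCellApproximable κ` — the integer-side DUAL of the kernel's rate: `L¹` approximability of the rough
  `Ω`-cells modulo Liouville by divisor sums of level `x^{1-η}` with defect `η^κ` (the line's open stub).
* `ApproxGivesKernel` — the positivity-duality transfer to the sibling crux's typed kernel
  `SectionAnnihilator.EffectiveRoughCellLawStrong` (exact for density `1/d`; needs the certificate's
  log-scale regularity for general `Ω(1,L')` densities).
-/

namespace Summit.Parity.GeneralizedHardyLittlewood.Cruxes.CellParityLawSaving.PermutationGhosts

open scoped BigOperators Classical
open Finset

/-- Cycle-index weight of a partition `C ⊢ n` on the `x`-grid `M`: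
`w_M(C) = ∏_{c ∈ C} (M/c) · M^{-(#C-1)} / ∏_v (count_v C)!` — the number of integers `m ≤ x^{n/M}` of
factorisation type `C`, in units of `x^{n/M}/log x` (equivalently `M ·` the probability that a uniform
permutation of `n` letters has cycle type `C`, rescaled to the grid). -/
noncomputable def permWeight (M : ℕ) {n : ℕ} (C : Nat.Partition n) : ℚ :=
  (C.parts.map (fun c => (M : ℚ) / c)).prod * ((M : ℚ)⁻¹) ^ (Multiset.card C.parts - 1) *
    (C.parts.toFinset.prod (fun v => (Nat.factorial (C.parts.count v) : ℚ)))⁻¹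

/-- Join of a divisor type `D ⊢ k` and a cofactor type `C ⊢ M - k`. -/
def join {M k : ℕ} (hk : k ≤ M) (D : Nat.Partition k) (C : Nat.Partition (M - k)) : Nat.Partition M :=
  Nat.Partition.ofSums M (D.parts + C.parts) (by rw [Multiset.sum_add, D.parts_sum, C.parts_sum]; omega)

/-- **Type-I invisibility at level `M - H`** in the permutation model: a perturbation `g` (relative density on
factorisation types of size-`x` integers) is invisible iff for every divisor type `D` of total size `≤ M - H`
(including `D = ∅`) its cofactor-average `Σ_{C ⊢ M-|D|} w_M(C) g(D ⊔ C)` vanishes. -/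
def InvisibleAt (M H : ℕ) (g : Nat.Partition M → ℚ) : Prop :=
  ∀ k : ℕ, ∀ hk : k + H ≤ M, ∀ D : Nat.Partition k,
    ∑ C : Nat.Partition (M - k), permWeight M C * g (join (by omega) D C) = 0

/-- The invisible perturbations form a submodule (bookkeeping). -/
noncomputable def invisibleSubmodule (M H : ℕ) : Submodule ℚ (Nat.Partition M → ℚ) where
  carrier := {g | InvisibleAt M H g}
  add_mem' := by
    intro a b ha hb k hk D
    have h1 := ha k hk D
    have h2 := hb k hk D
    simp only [Pi.add_apply, mul_add, Finset.sum_add_distrib, h1, h2, add_zero]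
  zero_mem' := by
    intro k hk D
    simp
  smul_mem' := by
    intro c g hg k hk D
    have h1 := hg k hk D
    have : ∑ C : Nat.Partition (M - k), permWeight M C * (c • g) (join (by omega) D C)
        = c * ∑ C : Nat.Partition (M - k), permWeight M C * g (join (by omega) D C) := by
      rw [Finset.mul_sum]
      refine Finset.sum_congr rfl fun C _ => ?_
      simp only [Pi.smul_apply, smul_eq_mul]
      ring
    rw [this, h1, mul_zero]

/-- **FIRST LEMMA (cycle-index vanishing; provable now).** For `1 ≤ j` and `n ≥ j + 1`,
`Σ_{C ⊢ n} (∏_{c∈C} 1/c) / (∏_v count_v!) · (-j)^{#C} = 0` — i.e. `Σ_{σ ∈ S_n} y^{cyc(σ)}/n! = y(y+1)⋯(y+n-1)/n!`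
vanishes at `y = -j` for `n > j`.  (In integer language: `(-j)^{Ω(m)}` has mean zero over the cofactors
`m ≤ x^{n/M}` as soon as `n > j` grid units — Selberg–Delange with `1/Γ(-j) = 0`.) -/
def CycleIndexVanishing : Prop :=
  ∀ n j : ℕ, 1 ≤ j → j + 1 ≤ n →
    ∑ C : Nat.Partition n, (C.parts.map (fun c => (c : ℚ)⁻¹)).prod *
      (C.parts.toFinset.prod (fun v => (Nat.factorial (C.parts.count v) : ℚ)))⁻¹ *
      (-(j : ℚ)) ^ Multiset.card C.parts = 0

/-- **The explicit ghost family at deficit `H`** (consequence of `CycleIndexVanishing`): for `1 ≤ j ≤ H - 1` the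
perturbation `T ↦ (-j)^{#parts T}` is invisible to Type-I data of level `M - H`.  `j = 1` is the parity
(Liouville) ghost, invisible from `H = 2` on; `j = 2, 3, …` are the higher ghosts that appear exactly as the
deficit grows. -/
def GhostFamily : Prop :=
  ∀ M H j : ℕ, 1 ≤ j → j + 1 ≤ H → H ≤ M →
    InvisibleAt M H (fun T => (-(j : ℚ)) ^ Multiset.card T.parts)

/-- **STRUCTURE THEOREM of the permutation model (Young's rule; verified numerically for `M ≤ 18`, `H ≤ 7`).**
The space of perturbations invisible at level `M - H` has dimension equal to the number of partitions of `M`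
all of whose parts are `< H` — it is the span of the irreducible `S_M`-characters `χ^λ` with `λ₁ < H`
(`H = 1`: nothing; `H = 2`: the sign character = parity alone, Bombieri's one free parameter; `H ≥ 3`: Ford's
fixed-level ghosts). -/
def InvisibleDimension : Prop :=
  ∀ M H : ℕ, 1 ≤ H → H ≤ M →
    Module.finrank ℚ (invisibleSubmodule M H) =
      Fintype.card {p : Nat.Partition M // ∀ i ∈ p.parts, i < H}

/-- **The parity-gap value** of the permutation model (the toy LP of kit jobs j024454/j024489/j024491):
`v(M,H)` = sup over invisible `g` with `|g| ≤ 1` of the mod-parity cell functional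
`C₁(g)/A₁ + C₂(g)/A₂` at roughness `u = 3` (cells = types with all parts `> M/3`).  Stated as the
finite-dimensional LP bound it is; `ParityGapDecay κ` asserts the polynomial decay in `η = H/M` that the typed
crux needs from ANY Type-I architecture. -/
def ParityGapLE (M H : ℕ) (v : ℚ) : Prop :=
  ∀ g : Nat.Partition M → ℚ, InvisibleAt M H g → (∀ T, |g T| ≤ 1) →
    (∑ T : Nat.Partition M, if Multiset.card T.parts = 1 then permWeight M T * g T else 0) /
        (∑ T : Nat.Partition M, if Multiset.card T.parts = 1 then permWeight M T else 0) +
      (∑ T : Nat.Partition M,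
          if Multiset.card T.parts = 2 ∧ (∀ i ∈ T.parts, M < 3 * i) then permWeight M T * g T else 0) /
        (∑ T : Nat.Partition M,
          if Multiset.card T.parts = 2 ∧ (∀ i ∈ T.parts, M < 3 * i) then permWeight M T else 0) ≤ v

/-- Polynomial decay of the parity gap in the deficit (uniformly in the grid): the shape of statement the LP
numerics test. -/
def ParityGapDecay (κ : ℝ) : Prop :=
  ∃ C : ℝ, 0 < C ∧ ∀ M H : ℕ, 3 ≤ H → 4 * H ≤ M → ∃ v : ℚ, ParityGapLE M H v ∧ (v : ℝ) ≤ C * ((H : ℝ) / M) ^ κ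

open ArithmeticFunction in
/-- **`RoughCellApproximable κ` — the integer-side dual of the kernel's rate (the line's open stub).**
For every roughness `u ≥ 2` and cell index `m ≥ 1` there are `C, η₀, x₀, A` such that for `x ≥ x₀`,
`z ∈ [x^{1/(u+1)}, x^{1/2}]`, `η ∈ [(log x)^{-1/2}, η₀]` there exist a parity amplitude `c` and divisor-sum
coefficients `λ_d`, supported on `d ≤ x^{1-η}` with `|λ_d| ≤ (log x)^A`, such that the indicator of the rough
`Ω`-cell `{n : P⁻(n) > z, Ω(n) = m}` is approximated on `(x/2, x]`, modulo `c·(-1)^{Ω(n)}`, by `n ↦ Σ_{d|n} λ_d`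
in `ℓ¹` up to `C(η^κ + (log z)^{-κ}) x/log x`.  By positivity (`0 ≤ a_q ≤ 1`) and `Σ_q a_q Σ_{d|q} λ_d =
Σ_d λ_d A_d`, this is EXACTLY what an effective Bombieri rough-cell law with rate `η^κ` needs for density `1/d`,
and (LP duality) the best rate provable from Type-I data + `0 ≤ a ≤ 1` equals the best defect here. -/
def RoughCellApproximable (κ : ℝ) : Prop :=
  ∀ u m : ℕ, 2 ≤ u → 1 ≤ m → ∃ (C η₀ x₀ : ℝ) (A : ℕ), 0 < η₀ ∧
    ∀ x z η : ℝ, x₀ ≤ x → x ^ (1 / ((u : ℝ) + 1)) ≤ z → z ≤ x ^ (1 / 2 : ℝ) →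
      Real.log x ^ (-(1 / 2 : ℝ)) ≤ η → η ≤ η₀ →
      ∃ (c : ℝ) (lam : ℕ → ℝ), (∀ d : ℕ, x ^ (1 - η) < d → lam d = 0) ∧ (∀ d : ℕ, |lam d| ≤ Real.log x ^ A) ∧
        ∑ n ∈ Finset.Ioc ⌊x / 2⌋₊ ⌊x⌋₊,
            |(if z < (Nat.minFac n : ℝ) ∧ cardFactors n = m then (1 : ℝ) else 0) -
                c * (-1 : ℝ) ^ cardFactors n - ∑ d ∈ n.divisors, lam d|
          ≤ C * (η ^ κ + Real.log z ^ (-κ)) * x / Real.log x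

/-- **The duality transfer** (stub of the line; exact for density `1/d`, and for general `Ω(1, L')` densities once
the certificate `λ_d = μ(d) h(log p₁/log x, …)` is piecewise smooth in the log-coordinates): an approximation
defect `η^κ` gives the sibling crux's typed kernel `EffectiveRoughCellLawStrong` (hence, along `u = U(N)` and with
the section atom at level `N·exp(-(log N)^{c₀})`, the SAVING of `CellParityLawSaving` with `δ = κ(1 - c₀)`). -/
def ApproxGivesKernel : Prop :=
  ∀ κ : ℝ, 0 < κ → RoughCellApproximable κ →
    Summit.Parity.GeneralizedHardyLittlewood.Cruxes.CellParityLaw.SectionAnnihilator.EffectiveRoughCellLawStrong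


/-! ## Idea 2 `deficit-renormalisation`: first checkable statements -/

/-- **Product structure of the weights (Poisson independence of large and small parts; provable now).**
If the divisor type `D` and the cofactor type `C` have no part size in common, the weight of the join factorises:
`w_M(D ⊔ C) = w_M(D) · w_M(C) / M`.  This is the formal basis of the renormalisation: conditioned on its parts
`≥ H₁`, the small-part configuration of a size-`x` integer is again a (scaled) cycle-index configuration. -/
def WeightJoinDisjoint : Prop :=
  ∀ (M k : ℕ) (hk : k ≤ M) (D : Nat.Partition k) (C : Nat.Partition (M - k)),
    Disjoint D.parts.toFinset C.parts.toFinset →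
      permWeight M (join hk D C) = permWeight M D * permWeight M C / M

/-- **Fibre deficit bookkeeping (provable now).** Type-I data of level `x^{1-η}` restricted to the multiples of a
divisor `d ≤ x^{1-η₁}` is Type-I data for the cofactor range `x/d` of RELATIVE level `(x/d)^{1-η/η₁}`: the
small-cofactor world of size `x^{η₁}` inherits deficit `η₂ = η/η₁`. -/
def FibreDeficit : Prop :=
  ∀ x d η η₁ : ℝ, 1 < x → 0 < η → 0 < η₁ → η ≤ η₁ → η₁ ≤ 1 → 1 ≤ d → d ≤ x ^ (1 - η₁) →
    (x / d) ^ (1 - η / η₁) ≤ x ^ (1 - η) / d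

/-- **Submultiplicativity of the parity gap (the renormalisation conjecture the LP ladder tests).**
With `v(M,H)` any admissible bound in `ParityGapLE`: there is an absolute `C` such that for `H < H₁ < M`
(`H₁` a valid coarse deficit, `4H₁ ≤ M`, and the small world `Model_{H₁}` in the sub-Ford regime `4H ≤ H₁`),
`v(M,H) ≤ C · v(M,H₁) · v(H₁,H)`.  One certified instance `C·v(M₀,H₀) < 1` then iterates to the polynomial rate
`v(η) ≪ η^κ`, `κ = log(1/(C v₀))/log(M₀/H₀)`. -/
def ParityGapSubmult : Prop :=
  ∃ C : ℚ, 0 < C ∧ ∀ M H₁ H : ℕ, 3 ≤ H → 4 * H ≤ H₁ → 4 * H₁ ≤ M →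
    ∀ v₁ v₂ : ℚ, ParityGapLE M H₁ v₁ → ParityGapLE H₁ H v₂ → ParityGapLE M H (C * v₁ * v₂)

end Summit.Parity.GeneralizedHardyLittlewood.Cruxes.CellParityLawSaving.PermutationGhosts
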